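import Mathlib
import Literature.AlgebraicGeometry.Resolution.FiniteQuotientSingularityPresentation
import Literature.RingTheory.KrullDimension.AffineDimension

/-!
# Affine quotients by finite groups as Galois-type quotient data (chain w45c, layer QD)

(crux stmt-ResolutionOfSingularities-15640 `WildQuotients.WildQuotientResolution`, line `Sketch`;
shared input of J2 `JordanBlockFourfold ⇐ CyclicQuotientFourfolds` and of programme T
`𝔸⁴/(J₂ ⊕ J₂)`; [OURS · L1 W4.5c] — NOT a statement of any manuscript.)

Let a finite group `G` act by `k`-algebra automorphisms on the `k`-algebra `B`
(`MulSemiringAction G B`, `SMulCommClass G k B`), with ring of invariants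
`A = B^G = FixedPoints.subalgebra k B G`. The crux `WildQuotientResolution` presents a quotient
through the data `(X′ = Spec B, X₁ = Spec A, q = Spec (A ⊆ B), ρ : G →* Aut X′)`; this file
provides the generic conjuncts of that data for affine quotients (SGA 1, Exp. V, §1; Mumford,
*Abelian Varieties*, §7):

* the ACTION on `Spec B`: `exists_specAction` — a homomorphism `ρ : G →* Aut (Spec B)` with
  `ρ g = Spec (g⁻¹)`; all further statements are about ANY `ρ` satisfying this characterisation
  (hypothesis `hρ`), so that users compose by hypothesis: `specAction_base_asIdeal` (`ρ g` maps the
  prime `𝔭` to `g • 𝔭`), `specAction_comp` (`ρ g ≫ q = q`), `exists_specAction_base_eq` (the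
  fibres of `q` are the `G`-orbits, Mathlib `Algebra.IsInvariant.exists_smul_of_under_eq`),
  `specAction_injective` (faithful on `Spec B` when faithful on `B`);
* `isFinite_specMap_fixedPoints`, `surjective_specMap_fixedPoints` (E. Noether: `B` is finite over
  `B^G`), `locallyOfFiniteType_specMap_fixedPoints` (`B^G` is of finite type over `k`);
* `topologicalKrullDim_spec_fixedPoints` (`dim Spec B^G = dim Spec B`, integral extensions preserve
  dimension), `topologicalKrullDim_spec_mvPolynomial` (`dim 𝔸ⁿ = n`).

Generic ÉTALENESS of `q` over the free locus `D(t)` is the sibling file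
`…Theorems.WildQuotientsWildQuotientResolutionAffineQuotientEtale` (`exists_dense_etale_morphismRestrict`).
-/

-- single-problem summit: the doubled namespace component `ResolutionOfSingularities` is forced
set_option linter.dupNamespace false

noncomputable section

universe u

open CategoryTheory AlgebraicGeometry TopologicalSpace
open scoped Pointwise
open Literature.AlgebraicGeometry.Resolution

namespace Summit.ResolutionOfSingularities.ResolutionOfSingularities.Theorems.WildQuotientResolution.AffineQuotient

variable (k : Type u) [Field k] {B : Type u} [CommRing B] [Algebra k B]
  {G : Type u} [Group G] [MulSemiringAction G B] [SMulCommClass G k B]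

/-! ## The action of `G` on `Spec B` -/

omit [Field k] [Algebra k B] [SMulCommClass G k B] in
/-- **The action `g ↦ Spec (g⁻¹)` of `G` on `Spec B`.** There is a group homomorphism
`ρ : G →* Aut (Spec B)` with `ρ g = Spec (g⁻¹ : B → B)` (the inverse makes the contravariant
`Spec` covariant in `g`). [folklore] -/
theorem exists_specAction (B : Type u) [CommRing B] (G : Type u) [Group G]
    [MulSemiringAction G B] :
    ∃ ρ : G →* Aut (Spec (CommRingCat.of B)), ∀ g : G, (ρ g).hom =
      Spec.map (CommRingCat.ofHom ((MulSemiringAction.toRingEquiv G B g⁻¹ : B ≃+* B) : B →+* B)) := by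
  refine ⟨MonoidHom.mk'
    (fun g => Scheme.Spec.mapIso (MulSemiringAction.toRingEquiv G B g⁻¹).toCommRingCatIso.op)
    (fun g h => ?_), fun g => rfl⟩
  apply Iso.ext
  change Spec.map (CommRingCat.ofHom
      ((MulSemiringAction.toRingEquiv G B (g * h)⁻¹ : B ≃+* B) : B →+* B)) =
    Spec.map (CommRingCat.ofHom ((MulSemiringAction.toRingEquiv G B h⁻¹ : B ≃+* B) : B →+* B)) ≫
      Spec.map (CommRingCat.ofHom ((MulSemiringAction.toRingEquiv G B g⁻¹ : B ≃+* B) : B →+* B))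
  rw [← Spec.map_comp, ← CommRingCat.ofHom_comp]
  congr 2
  refine RingHom.ext fun b => ?_
  simp only [RingHom.coe_comp, RingHom.coe_coe, Function.comp_apply,
    MulSemiringAction.toRingEquiv_apply_apply, mul_inv_rev, mul_smul]

omit [Field k] [Algebra k B] [SMulCommClass G k B] in
/-- **`ρ g` maps the prime `𝔭` to `g • 𝔭`** (for any `ρ` with `ρ g = Spec (g⁻¹)`): the preimage of
`𝔭` under `g⁻¹` is its image under `g`. [folklore] -/
theorem specAction_base_asIdeal (ρ : G →* Aut (Spec (CommRingCat.of B)))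
    (hρ : ∀ g : G, (ρ g).hom =
      Spec.map (CommRingCat.ofHom ((MulSemiringAction.toRingEquiv G B g⁻¹ : B ≃+* B) : B →+* B)))
    (g : G) (x : Spec (CommRingCat.of B)) :
    ((ρ g).hom.base x).asIdeal = g • x.asIdeal := by
  rw [hρ]
  ext b
  -- `b ∈ (g⁻¹)⁻¹(𝔭ₓ) ↔ g⁻¹ • b ∈ 𝔭ₓ ↔ b ∈ g • 𝔭ₓ`
  exact (Ideal.mem_pointwise_smul_iff_inv_smul_mem (a := g) (S := x.asIdeal) (x := b)).symm

/-- **The quotient map is invariant: `ρ g ≫ q = q`** for `q = Spec (B^G ⊆ B)` and any `ρ` with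
`ρ g = Spec (g⁻¹)` (`g⁻¹` fixes `B^G` pointwise). [folklore] -/
theorem specAction_comp (ρ : G →* Aut (Spec (CommRingCat.of B)))
    (hρ : ∀ g : G, (ρ g).hom =
      Spec.map (CommRingCat.ofHom ((MulSemiringAction.toRingEquiv G B g⁻¹ : B ≃+* B) : B →+* B)))
    (g : G) :
    (ρ g).hom ≫ Spec.map (CommRingCat.ofHom (algebraMap (FixedPoints.subalgebra k B G) B)) =
      Spec.map (CommRingCat.ofHom (algebraMap (FixedPoints.subalgebra k B G) B)) := by
  rw [hρ, ← Spec.map_comp, ← CommRingCat.ofHom_comp]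
  congr 2
  refine RingHom.ext fun a => ?_
  change MulSemiringAction.toRingEquiv G B g⁻¹ (a : B) = (a : B)
  rw [MulSemiringAction.toRingEquiv_apply_apply]
  exact a.2 g⁻¹

/-- **The fibres of `q = Spec (B^G ⊆ B)` are the `G`-orbits**: two primes of `B` over the same
prime of `B^G` are conjugate (Mathlib `Algebra.IsInvariant.exists_smul_of_under_eq`), so some
`ρ g` moves one to the other. [cite: SGA1, Exp. V, Prop. 1.1 (ii)] -/
theorem exists_specAction_base_eq [Finite G] (ρ : G →* Aut (Spec (CommRingCat.of B)))
    (hρ : ∀ g : G, (ρ g).hom =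
      Spec.map (CommRingCat.ofHom ((MulSemiringAction.toRingEquiv G B g⁻¹ : B ≃+* B) : B →+* B)))
    (x y : Spec (CommRingCat.of B))
    (hxy : (Spec.map (CommRingCat.ofHom (algebraMap (FixedPoints.subalgebra k B G) B))).base x =
      (Spec.map (CommRingCat.ofHom (algebraMap (FixedPoints.subalgebra k B G) B))).base y) :
    ∃ g : G, (ρ g).hom.base x = y := by
  have hxy' : x.asIdeal.under (FixedPoints.subalgebra k B G) =
      y.asIdeal.under (FixedPoints.subalgebra k B G) := congrArg PrimeSpectrum.asIdeal hxy
  obtain ⟨g, hg⟩ := Algebra.IsInvariant.exists_smul_of_under_eq (FixedPoints.subalgebra k B G) B G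
    x.asIdeal y.asIdeal hxy'
  exact ⟨g, PrimeSpectrum.ext ((specAction_base_asIdeal ρ hρ g x).trans hg.symm)⟩

omit [Field k] [Algebra k B] [SMulCommClass G k B] in
/-- **A faithful action on `B` acts faithfully on `Spec B`**: if `ρ g = ρ h` then
`Spec (g⁻¹) = Spec (h⁻¹)`, so `g⁻¹ = h⁻¹` on `B` (`Spec` is faithful on ring maps), so `g = h`.
[folklore] -/
theorem specAction_injective [FaithfulSMul G B] (ρ : G →* Aut (Spec (CommRingCat.of B)))
    (hρ : ∀ g : G, (ρ g).hom =
      Spec.map (CommRingCat.ofHom ((MulSemiringAction.toRingEquiv G B g⁻¹ : B ≃+* B) : B →+* B))) :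
    Function.Injective ρ := by
  intro g h hgh
  have h1 : (ρ g).hom = (ρ h).hom := by rw [hgh]
  rw [hρ, hρ, Spec.map_inj] at h1
  have h2 : ∀ b : B, g⁻¹ • b = h⁻¹ • b := fun b => by
    have := congrArg (fun f : CommRingCat.of B ⟶ CommRingCat.of B => f.hom b) h1
    simpa [MulSemiringAction.toRingEquiv_apply_apply] using this
  exact inv_injective (FaithfulSMul.eq_of_smul_eq_smul h2)

/-! ## Finiteness, surjectivity, finite type, dimension -/

/-- **`q : Spec B → Spec B^G` is finite** (E. Noether: `B` is a finite `B^G`-module when `B` is of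
finite type over `k`; `Literature.AlgebraicGeometry.Resolution.finite_fixedPointsSubalgebra`).
[cite: SGA1, Exp. V, Cor. 1.5] -/
theorem isFinite_specMap_fixedPoints [Finite G] [Algebra.FiniteType k B] :
    IsFinite (Spec.map (CommRingCat.ofHom (algebraMap (FixedPoints.subalgebra k B G) B))) := by
  rw [IsFinite.SpecMap_iff, CommRingCat.hom_ofHom, RingHom.finite_algebraMap]
  infer_instance

/-- **`q : Spec B → Spec B^G` is surjective** (`B` is integral over `B^G`). [cite: SGA1, Exp. V, Prop. 1.1 (i)] -/
theorem surjective_specMap_fixedPoints [Finite G] :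
    Function.Surjective
      (Spec.map (CommRingCat.ofHom (algebraMap (FixedPoints.subalgebra k B G) B))).base := by
  haveI : FaithfulSMul (FixedPoints.subalgebra k B G) B :=
    (faithfulSMul_iff_algebraMap_injective _ _).mpr Subtype.val_injective
  exact Algebra.IsIntegral.comap_surjective _ _

/-- **`Spec B^G → Spec k` is locally of finite type** (E. Noether's finiteness theorem:
`Literature.AlgebraicGeometry.Resolution.finiteType_fixedPointsSubalgebra`).
[cite: SGA1, Exp. V, Cor. 1.5] -/
theorem locallyOfFiniteType_specMap_fixedPoints [Finite G] [Algebra.FiniteType k B] :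
    LocallyOfFiniteType
      (Spec.map (CommRingCat.ofHom (algebraMap k (FixedPoints.subalgebra k B G)))) := by
  rw [HasRingHomProperty.Spec_iff (P := @LocallyOfFiniteType), CommRingCat.hom_ofHom,
    RingHom.finiteType_algebraMap]
  infer_instance

/-- **`dim Spec B^G = dim Spec B`** for a domain `B`: `B` is integral over `B^G` and integral
extensions preserve Krull dimension
(`Literature.RingTheory.KrullDimension.ringKrullDim_eq_of_isIntegral`). [cite: Matsumura1987, Thm 9.4] -/
theorem topologicalKrullDim_spec_fixedPoints [IsDomain B] [Finite G] :
    topologicalKrullDim (Spec (CommRingCat.of (FixedPoints.subalgebra k B G))) =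
      topologicalKrullDim (Spec (CommRingCat.of B)) := by
  change topologicalKrullDim (PrimeSpectrum (FixedPoints.subalgebra k B G)) =
    topologicalKrullDim (PrimeSpectrum B)
  rw [PrimeSpectrum.topologicalKrullDim_eq_ringKrullDim,
    PrimeSpectrum.topologicalKrullDim_eq_ringKrullDim]
  exact Literature.RingTheory.KrullDimension.ringKrullDim_eq_of_isIntegral
    (R := FixedPoints.subalgebra k B G) (S := B) Subtype.val_injective

omit [Algebra k B] [SMulCommClass G k B] in
/-- **`dim 𝔸ⁿ_k = n`** (as the topological Krull dimension of `Spec k[x₁,…,xₙ]`). [folklore] -/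
theorem topologicalKrullDim_spec_mvPolynomial (n : ℕ) :
    topologicalKrullDim (Spec (CommRingCat.of (MvPolynomial (Fin n) k))) = n := by
  change topologicalKrullDim (PrimeSpectrum (MvPolynomial (Fin n) k)) = n
  rw [PrimeSpectrum.topologicalKrullDim_eq_ringKrullDim, MvPolynomial.ringKrullDim_of_isNoetherianRing,
    ringKrullDim_eq_zero_of_field]
  simp

end Summit.ResolutionOfSingularities.ResolutionOfSingularities.Theorems.WildQuotientResolution.AffineQuotient

end
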